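import Summits.BirchSwinnertonDyer.Rank1Residual.ManinAdditive.SigmaThetaParity
import HarnessLib

/-!
# THE NODE S-an-g34-2 `KroneckerShimuraCharAtFour`, statement spelled out: `exists_shimuraTwoChar_eq_jacobiSym` (an g35, T-an-37, Part A 2/3)

TYPER NOTE (typer g19, TURNKEY T-an-37 v2, part 2/3 of file A).  SOURCE = HOME/an/g35/SigmaThetaParity-an-g35-v2.lean sha16 3284279ff549c8a2,
lines 333–677 VERBATIM (one-line docstrings added on undocumented helper lemmas); imports part 1 `SigmaThetaParity` (Jacobi/Kronecker
lemmas, `kroneckerChar`, divisor bookkeeping, cusp conditions); this part opens with the fibre sums `Xfib`, `sum_eq_sum_fiber`, `parity_arith`.  CONTENT (an's words): for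
`4 ∣ N`, an exponent vector `2r` on the divisors of `N` with Newman's congruences and EVEN cusp orders of the `η`-quotient `∏ η(tτ)^{2 r_t}`,
the Kronecker symbol `d ↦ (s' | |d|)`, `s' = ∏ t^{|r_t|}`, restricted to odd `d` coprime to `N`, is the restriction of an even quadratic
Dirichlet character `χ mod N` which kills every cusp stabiliser `1 + a·c·(N / gcd(N, c²))` of `Γ₀(N)` — the body of
`SigmaTheta.KroneckerShimuraCharAtFour` token-for-token with the binders explicit (PARITY LEMMA 1 «2 ∣ q ⟹ 32 ∣ N» and PARITY LEMMA 2
«4 ∥ N ⟹ q ≡ 1 mod 4» are derived inside the main proof from the cusp conditions at `c = 2^i·M`; ref1 §R140 (b)'s prover note is exactly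
this).  The by-name closure `kroneckerShimuraCharAtFour_holds` lives in `SigmaThetaHolds.lean`.  Theorem-only; nothing conjectured.
PARTITION 0 · beyond-print theorem: yes, modest (an: a kernel-checked level law; print has Newman/Ligozat criteria) · BSD / C2 / Manin `c = 1`
NOT proved by this.
-/

namespace Summit.BirchSwinnertonDyer.Rank1Residual.ManinAdditive.SigmaEta

open Literature.NumberTheory.ModularForms
open Literature.NumberTheory.EllipticCurves.ModularForms
open scoped NumberTheorySymbols
open ZMod


/-! ### Fibres of `v₂` and the arithmetic of the cusp conditions -/

/-- `X_j = Σ_{t ∣ N, v₂(t) = j} r_t · oddpart(t)`. -/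
def Xfib (N : ℕ) (r : ℕ → ℤ) (j : ℕ) : ℤ :=
  ∑ t ∈ N.divisors with t.factorization 2 = j, r t * (ordCompl[2] t : ℤ)

/-- Regrouping a sum over the divisors of `2ⁿ·M` by the `2`-adic valuation: the fibre sums `Xfib`. -/
theorem sum_eq_sum_fiber {n M : ℕ} (hM : Odd M) (r : ℕ → ℤ) (w : ℕ → ℤ) :
    ∑ t ∈ (2 ^ n * M).divisors, r t * (ordCompl[2] t : ℤ) * w (t.factorization 2)
      = ∑ j ∈ Finset.range (n + 1), w j * Xfib (2 ^ n * M) r j := by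
  rw [← Finset.sum_fiberwise_of_maps_to (s := (2 ^ n * M).divisors) (t := Finset.range (n + 1))
    (g := fun t => t.factorization 2) ?_]
  · refine Finset.sum_congr rfl fun j _ => ?_
    rw [Xfib, Finset.mul_sum]
    refine Finset.sum_congr rfl fun t ht => ?_
    rw [(Finset.mem_filter.mp ht).2]
    ring
  · intro t ht
    exact Finset.mem_range.mpr (Nat.lt_succ_of_le (divisor_two_adic hM (Nat.dvd_of_mem_divisors ht)).2.2.2)

/-- The linear algebra mod powers of `2` behind the parity lemmas (`n = v₂(N) ∈ {2,3,4}`). -/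
theorem parity_arith (n : ℕ) (hn2 : 2 ≤ n) (hn4 : n ≤ 4) (X : ℕ → ℤ)
    (hT : ∀ i ≤ n, (24 * 2 ^ (i + min i (n - i)) : ℤ) ∣
      ∑ j ∈ Finset.range (n + 1), 2 ^ (2 * min i j + (n - j)) * X j)
    (hpar : 2 ∣ ∑ j ∈ Finset.range (n + 1), X j) :
    2 ∣ ∑ j ∈ Finset.range (n + 1), (j : ℤ) * X j ∧ (n = 2 → 4 ∣ ∑ j ∈ Finset.range (n + 1), X j) := by
  interval_cases n
  · have h0 := hT 0 (by norm_num)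
    have h1 := hT 1 (by norm_num)
    have h2 := hT 2 (by norm_num)
    simp only [Finset.sum_range_succ, Finset.sum_range_zero, Nat.min_def] at h0 h1 h2 hpar ⊢
    norm_num at h0 h1 h2 hpar ⊢
    omega
  · have h0 := hT 0 (by norm_num)
    have h1 := hT 1 (by norm_num)
    have h2 := hT 2 (by norm_num)
    have h3 := hT 3 (by norm_num)
    simp only [Finset.sum_range_succ, Finset.sum_range_zero, Nat.min_def] at h0 h1 h2 h3 hpar ⊢
    norm_num at h0 h1 h2 h3 hpar ⊢
    omega
  · have h0 := hT 0 (by norm_num)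
    have h1 := hT 1 (by norm_num)
    have h2 := hT 2 (by norm_num)
    have h3 := hT 3 (by norm_num)
    have h4 := hT 4 (by norm_num)
    simp only [Finset.sum_range_succ, Finset.sum_range_zero, Nat.min_def] at h0 h1 h2 h3 h4 hpar ⊢
    norm_num at h0 h1 h2 h3 h4 hpar ⊢
    omega


/-! ### The product `s' = ∏ t^{|r_t|} = 2^V · S` -/

/-- `s' = ∏ t^{|r_t|} = 2^V · S` with `S` the product of the odd parts. -/
theorem prod_pow_natAbs_eq {n M : ℕ} (hM : Odd M) (r : ℕ → ℤ) :
    ∏ t ∈ (2 ^ n * M).divisors, t ^ (r t).natAbs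
      = 2 ^ (∑ t ∈ (2 ^ n * M).divisors, t.factorization 2 * (r t).natAbs) *
        ∏ t ∈ (2 ^ n * M).divisors, (ordCompl[2] t) ^ (r t).natAbs := by
  rw [← Finset.prod_pow_eq_pow_sum, ← Finset.prod_mul_distrib]
  refine Finset.prod_congr rfl fun t ht => ?_
  obtain ⟨hdec, -, -, -⟩ := divisor_two_adic hM (Nat.dvd_of_mem_divisors ht)
  have h : t ^ (r t).natAbs = (2 ^ t.factorization 2 * ordCompl[2] t) ^ (r t).natAbs := by rw [← hdec]
  rw [h, mul_pow, ← pow_mul]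

/-- The odd-part product `S = ∏ oddpart(t)^{|r_t|}` is odd. -/
theorem prod_ordCompl_pow_odd {n M : ℕ} (hM : Odd M) (r : ℕ → ℤ) :
    Odd (∏ t ∈ (2 ^ n * M).divisors, (ordCompl[2] t) ^ (r t).natAbs) := by
  rw [← Nat.coprime_two_left]
  exact Nat.Coprime.prod_right fun t ht =>
    Nat.Coprime.pow_right _ (Nat.coprime_two_left.mpr (divisor_two_adic hM (Nat.dvd_of_mem_divisors ht)).2.1)

/-- `|r| ≡ r·u (mod 2)` for odd `u`. -/
theorem two_dvd_natAbs_sub_mul_odd (r : ℤ) {u : ℕ} (hu : Odd u) : (2 : ℤ) ∣ (r.natAbs : ℤ) - r * u := by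
  obtain ⟨k, hk⟩ := hu
  rcases Int.natAbs_eq r with h | h
  · rw [← h, hk]; push_cast; exact ⟨-(r * k), by ring⟩
  · have h' : (r.natAbs : ℤ) = -r := by linarith
    rw [h', hk]; push_cast; exact ⟨-(r * (k + 1)), by ring⟩

/-- `r·u ≡ r (mod 2)` for odd `u`. -/
theorem two_dvd_mul_odd_sub (r : ℤ) {u : ℕ} (hu : Odd u) : (2 : ℤ) ∣ r * u - r := by
  obtain ⟨k, hk⟩ := hu
  rw [hk]; push_cast; exact ⟨r * k, by ring⟩

/-- The 2-adic facts about the squarefree kernel `q` of `b²·q = 2^V·S` (`S` odd). -/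
theorem squarefree_kernel_two_adic {V S q b : ℕ} (hS : Odd S) (hsq : Squarefree q) (hq : 0 < q) (hb : 0 < b)
    (h : b ^ 2 * q = 2 ^ V * S) : (Even V → ¬ 2 ∣ q) ∧ (¬ 2 ∣ q → q % 4 = S % 4) := by
  haveI := Fact.mk Nat.prime_two
  have hv : padicValNat 2 (b ^ 2 * q) = padicValNat 2 (2 ^ V * S) := by rw [h]
  rw [padicValNat.mul (by positivity) hq.ne', padicValNat.pow b 2, padicValNat.mul (by positivity) hS.pos.ne',
    padicValNat.prime_pow, padicValNat.eq_zero_of_not_dvd hS.not_two_dvd_nat, add_zero] at hv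
  constructor
  · intro hV h2
    have h4 : ¬ 2 ^ 2 ∣ q := fun h4 => by
      have := Nat.isUnit_iff.mp (hsq 2 (by simpa [pow_two] using h4))
      omega
    have h1 : 1 ≤ padicValNat 2 q := (padicValNat_dvd_iff_le hq.ne').mp (by simpa using h2)
    have h2' : ¬ 2 ≤ padicValNat 2 q := fun hle => h4 ((padicValNat_dvd_iff_le hq.ne').mpr hle)
    obtain ⟨k, hk⟩ := hV
    omega
  · intro hqodd
    have hvq : padicValNat 2 q = 0 := padicValNat.eq_zero_of_not_dvd hqodd
    obtain ⟨β, b', hb'2, hbe⟩ := Nat.exists_eq_pow_mul_and_not_dvd hb.ne' 2 (by norm_num)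
    have hb'0 : b' ≠ 0 := by rintro rfl; simp at hb'2
    have hvb : padicValNat 2 b = β := by
      rw [hbe, padicValNat.mul (by positivity) hb'0, padicValNat.prime_pow, padicValNat.eq_zero_of_not_dvd hb'2,
        add_zero]
    have hV : V = 2 * β := by omega
    have hS' : b' ^ 2 * q = S := by
      have : 2 ^ V * (b' ^ 2 * q) = 2 ^ V * S := by rw [← h, hbe, hV]; ring
      exact Nat.eq_of_mul_eq_mul_left (by positivity) this
    rw [← hS', Nat.mul_mod, Nat.pow_mod]
    have hb'odd : b' % 2 = 1 := Nat.two_dvd_ne_zero.mp hb'2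
    have : b' % 4 = 1 ∨ b' % 4 = 3 := by omega
    rcases this with h4 | h4 <;> rw [h4] <;> norm_num

/-- A product of odd numbers is `≡ 1 (mod 4)` iff an even number of factors (with multiplicity) are `≡ 3 (mod 4)`. -/
theorem prod_odd_pow_mod_four {ι : Type*} (D : Finset ι) (u : ι → ℕ) (k : ι → ℕ) (hu : ∀ t ∈ D, Odd (u t))
    (heven : Even (∑ t ∈ D, (u t / 2) * k t)) : (∏ t ∈ D, u t ^ k t) % 4 = 1 := by
  have h4 : (4 : ZMod 4) = 0 := by decide
  have key : ∀ t ∈ D, ((u t ^ k t : ℕ) : ZMod 4) = (-1) ^ ((u t / 2) * k t) := by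
    intro t ht
    rw [Nat.cast_pow, pow_mul]
    congr 1
    obtain ⟨m, hm⟩ := hu t ht
    rw [hm, show (2 * m + 1) / 2 = m by omega]
    rcases Nat.even_or_odd m with ⟨l, hl⟩ | ⟨l, hl⟩
    · rw [Even.neg_one_pow ⟨l, hl⟩, hl]; push_cast; linear_combination (l : ZMod 4) * h4
    · rw [Odd.neg_one_pow ⟨l, hl⟩, hl]; push_cast; linear_combination ((l : ZMod 4) + 1) * h4
  have h : ((∏ t ∈ D, u t ^ k t : ℕ) : ZMod 4) = 1 := by
    rw [Nat.cast_prod, Finset.prod_congr rfl key, Finset.prod_pow_eq_pow_sum, Even.neg_one_pow heven]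
  have h1 : ((∏ t ∈ D, u t ^ k t : ℕ) : ZMod 4) = ((1 : ℕ) : ZMod 4) := by rw [Nat.cast_one]; exact h
  have := (ZMod.natCast_eq_natCast_iff' _ _ _).mp h1
  norm_num at this
  exact this

/-! ### The node -/

/-- **The node S-an-g34-2, statement spelled out** (verbatim the body of `SigmaTheta.KroneckerShimuraCharAtFour`): at `4 ∣ N`, for an
exponent vector `2r` with Newman's congruences and even cusp orders, `d ↦ (∏ t^{|r_t|} | |d|)` on odd `d` coprime to `N` is the
restriction of an even quadratic Dirichlet character mod `N` killing every cusp stabiliser `1 + a·c·(N/gcd(N,c²))`. -/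
theorem exists_shimuraTwoChar_eq_jacobiSym (N : ℕ) (h4N : 4 ∣ N) (r : ℕ → ℤ) (hNew : NewmanCond N (fun t => 2 * r t) 0)
    (hev : HasEvenCuspOrders N (fun t => 2 * r t)) :
    ∃ χ : DirichletCharacter ℤ N, IsShimuraTwoChar N χ ∧
      ∀ d : ℤ, Odd d → IsCoprime d N →
        J(((∏ t ∈ N.divisors, t ^ (r t).natAbs : ℕ) : ℤ) | d.natAbs) = χ (d : ZMod N) := by
  rcases Nat.eq_zero_or_pos N with rfl | hNpos
  · -- degenerate level `N = 0` (`ZMod 0 = ℤ`, no divisors, `s' = 1`): the trivial character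
    refine ⟨1, ⟨MulChar.one_apply isUnit_one.neg, ?_⟩, ?_⟩
    · intro a c _ _; simp
    · intro d _ hcop
      have hu : IsUnit d := isCoprime_zero_right.mp (by simpa using hcop)
      rw [MulChar.one_apply (x := (Int.cast (R := ZMod 0) d)) (hu.map (Int.castRingHom (ZMod 0))),
        Nat.divisors_zero, Finset.prod_empty, Nat.cast_one, jacobiSym.one_left]
  obtain ⟨n, M, hM, hNM⟩ := Nat.exists_eq_two_pow_mul_odd hNpos.ne'
  subst hNM
  have hN0 : 2 ^ n * M ≠ 0 := hNpos.ne'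
  have hn2 : 2 ≤ n := by
    have h' : 2 ^ 2 ∣ 2 ^ n * M := by rw [show (2 : ℕ) ^ 2 = 4 by norm_num]; exact h4N
    exact (Nat.pow_dvd_pow_iff_le_right (by norm_num)).mp
      (((Nat.coprime_two_left.mpr hM).pow_left 2).dvd_of_dvd_mul_right h')
  set D := (2 ^ n * M).divisors with hD
  have hsum0 : ∑ t ∈ D, r t = 0 := by
    have h := hNew.sum_eq; rw [← Finset.mul_sum] at h; linarith
  -- the cusp conditions in fibre form
  have hT : ∀ i ≤ n, (24 * 2 ^ (i + min i (n - i)) : ℤ) ∣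
      ∑ j ∈ Finset.range (n + 1), 2 ^ (2 * min i j + (n - j)) * Xfib (2 ^ n * M) r j := by
    intro i hi
    have h := cusp_condition_two_pow hM r hev hi
    rwa [sum_eq_sum_fiber hM r (fun j => (2 : ℤ) ^ (2 * min i j + (n - j)))] at h
  have hXsum : ∑ j ∈ Finset.range (n + 1), Xfib (2 ^ n * M) r j = ∑ t ∈ D, r t * (ordCompl[2] t : ℤ) := by
    have := sum_eq_sum_fiber (n := n) hM r (fun _ => 1)
    simp only [mul_one, one_mul] at this
    exact this.symm
  have hpar : (2 : ℤ) ∣ ∑ j ∈ Finset.range (n + 1), Xfib (2 ^ n * M) r j := by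
    rw [hXsum]
    have e : ∑ t ∈ D, r t * (ordCompl[2] t : ℤ) = ∑ t ∈ D, (r t * (ordCompl[2] t : ℤ) - r t) + ∑ t ∈ D, r t := by
      rw [← Finset.sum_add_distrib]; simp
    rw [e, hsum0, add_zero]
    exact Finset.dvd_sum fun t ht => two_dvd_mul_odd_sub (r t) (divisor_two_adic hM (Nat.dvd_of_mem_divisors ht)).2.1
  have hjX : ∑ j ∈ Finset.range (n + 1), (j : ℤ) * Xfib (2 ^ n * M) r j
      = ∑ t ∈ D, r t * (ordCompl[2] t : ℤ) * (t.factorization 2 : ℤ) :=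
    (sum_eq_sum_fiber (n := n) hM r (fun j => (j : ℤ))).symm
  -- `s' = 2^V · S`
  set V := ∑ t ∈ D, t.factorization 2 * (r t).natAbs with hV
  set S := ∏ t ∈ D, (ordCompl[2] t) ^ (r t).natAbs with hS
  have hsVS : ∏ t ∈ D, t ^ (r t).natAbs = 2 ^ V * S := prod_pow_natAbs_eq hM r
  have hSodd : Odd S := prod_ordCompl_pow_odd hM r
  -- PARITY LEMMA 1: `¬ 32 ∣ N ⟹ v₂(s')` even
  have hL1 : n ≤ 4 → Even V := by
    intro hn4
    have h2 := (parity_arith n hn2 hn4 _ hT hpar).1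
    rw [hjX] at h2
    have hdiff : (2 : ℤ) ∣ (V : ℤ) - ∑ t ∈ D, r t * (ordCompl[2] t : ℤ) * (t.factorization 2 : ℤ) := by
      rw [hV, Nat.cast_sum]
      simp only [Nat.cast_mul]
      rw [← Finset.sum_sub_distrib]
      exact Finset.dvd_sum fun t ht => by
        have h := two_dvd_natAbs_sub_mul_odd (r t) (divisor_two_adic hM (Nat.dvd_of_mem_divisors ht)).2.1
        have e : ((t.factorization 2 : ℕ) : ℤ) * ((r t).natAbs : ℤ) - r t * (ordCompl[2] t : ℤ) * (t.factorization 2 : ℤ)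
            = (t.factorization 2 : ℤ) * (((r t).natAbs : ℤ) - r t * (ordCompl[2] t : ℤ)) := by ring
        rw [e]; exact Dvd.dvd.mul_left h _
    have h2V : (2 : ℤ) ∣ (V : ℤ) := by have := dvd_add hdiff h2; simpa using this
    exact even_iff_two_dvd.mpr (Int.natCast_dvd_natCast.mp h2V)
  -- PARITY LEMMA 2: `4 ∥ N ⟹ Σ_t |r_t|·(u_t − 1)/2` even
  have hL2 : n = 2 → Even (∑ t ∈ D, (ordCompl[2] t / 2) * (r t).natAbs) := by
    intro hn
    have h4 := (parity_arith n hn2 (by omega) _ hT hpar).2 hn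
    rw [hXsum] at h4
    have hsplit : ∑ t ∈ D, r t * (ordCompl[2] t : ℤ)
        = 2 * ∑ t ∈ D, r t * ((ordCompl[2] t / 2 : ℕ) : ℤ) + ∑ t ∈ D, r t := by
      rw [Finset.mul_sum, ← Finset.sum_add_distrib]
      refine Finset.sum_congr rfl fun t ht => ?_
      have hodd := (divisor_two_adic hM (Nat.dvd_of_mem_divisors ht)).2.1
      have hu : (ordCompl[2] t : ℤ) = 2 * ((ordCompl[2] t / 2 : ℕ) : ℤ) + 1 := by
        have h := Nat.div_add_mod (ordCompl[2] t) 2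
        rw [Nat.odd_iff.mp hodd] at h
        exact_mod_cast h.symm
      rw [hu]; ring
    rw [hsplit, hsum0, add_zero] at h4
    have hW : (2 : ℤ) ∣ ∑ t ∈ D, r t * ((ordCompl[2] t / 2 : ℕ) : ℤ) := by
      rw [show (4 : ℤ) = 2 * 2 by norm_num] at h4
      exact (mul_dvd_mul_iff_left two_ne_zero).mp h4
    have hdiff : (2 : ℤ) ∣ (∑ t ∈ D, ((ordCompl[2] t / 2 : ℕ) : ℤ) * ((r t).natAbs : ℤ))
        - ∑ t ∈ D, r t * ((ordCompl[2] t / 2 : ℕ) : ℤ) := by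
      rw [← Finset.sum_sub_distrib]
      exact Finset.dvd_sum fun t ht => by
        have h := two_dvd_natAbs_sub_mul_odd (r t) odd_one
        simp only [Nat.cast_one, mul_one] at h
        have e : ((ordCompl[2] t / 2 : ℕ) : ℤ) * ((r t).natAbs : ℤ) - r t * ((ordCompl[2] t / 2 : ℕ) : ℤ)
            = ((ordCompl[2] t / 2 : ℕ) : ℤ) * (((r t).natAbs : ℤ) - r t) := by ring
        rw [e]; exact Dvd.dvd.mul_left h _
    have h2Z : (2 : ℤ) ∣ ∑ t ∈ D, ((ordCompl[2] t / 2 : ℕ) : ℤ) * ((r t).natAbs : ℤ) := by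
      have := dvd_add hdiff hW; simpa using this
    have hcast : ((∑ t ∈ D, (ordCompl[2] t / 2) * (r t).natAbs : ℕ) : ℤ)
        = ∑ t ∈ D, ((ordCompl[2] t / 2 : ℕ) : ℤ) * ((r t).natAbs : ℤ) := by
      rw [Nat.cast_sum]; simp only [Nat.cast_mul]
    rw [← hcast] at h2Z
    exact even_iff_two_dvd.mpr (Int.natCast_dvd_natCast.mp h2Z)
  -- the squarefree kernel `q` of `s'`
  have hs0 : 0 < ∏ t ∈ D, t ^ (r t).natAbs := Finset.prod_pos fun t ht => pow_pos (Nat.pos_of_mem_divisors ht) _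
  obtain ⟨q, b, hq0, hb0, hbq, hsq⟩ := Nat.sq_mul_squarefree_of_pos hs0
  rw [hsVS] at hbq
  have hqfacts := squarefree_kernel_two_adic hSodd hsq hq0 hb0 hbq
  have hQ2 : 2 ∣ q → 5 ≤ n := by
    intro h2; by_contra hlt; exact hqfacts.1 (hL1 (by omega)) h2
  have hQ3 : n = 2 → q % 4 = 1 := by
    intro hn
    have hqodd : ¬ 2 ∣ q := fun h2 => by have := hQ2 h2; omega
    rw [hqfacts.2 hqodd]
    exact prod_odd_pow_mod_four D (fun t => ordCompl[2] t) (fun t => (r t).natAbs)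
      (fun t ht => (divisor_two_adic hM (Nat.dvd_of_mem_divisors ht)).2.1) (hL2 hn)
  -- `s' ∣ N^K`, `q ∣ N`, `4q ∣ N`
  have hsN : (∏ t ∈ D, t ^ (r t).natAbs) ∣ (2 ^ n * M) ^ (∑ t ∈ D, (r t).natAbs) := by
    rw [← Finset.prod_pow_eq_pow_sum]
    exact Finset.prod_dvd_prod_of_dvd _ _ fun t ht => pow_dvd_pow_of_dvd (Nat.dvd_of_mem_divisors ht) _
  have hqN : q ∣ 2 ^ n * M := by
    have hq_s : q ∣ ∏ t ∈ D, t ^ (r t).natAbs := by rw [hsVS, ← hbq]; exact Dvd.intro_left _ rfl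
    have : q ∣ (2 ^ n * M) ^ (∑ t ∈ D, (r t).natAbs + 1) :=
      (hq_s.trans hsN).trans (pow_dvd_pow _ (Nat.le_succ _))
    exact (hsq.dvd_pow_iff_dvd (Nat.succ_ne_zero _)).mp this
  have h4qN : 4 * q ∣ 2 ^ n * M := by
    by_cases h2 : 2 ∣ q
    · have hn5 := hQ2 h2
      obtain ⟨q', hq'⟩ := h2
      have hq'odd : ¬ 2 ∣ q' := by
        intro h
        have h4 : 2 * 2 ∣ q := by rw [hq']; exact Nat.mul_dvd_mul_left 2 h
        have := Nat.isUnit_iff.mp (hsq 2 h4)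
        omega
      have h8 : 8 ∣ 2 ^ n * M := by
        have : (8 : ℕ) = 2 ^ 3 := by norm_num
        rw [this]; exact (pow_dvd_pow 2 (by omega)).trans (Dvd.intro _ rfl)
      have hq'N : q' ∣ 2 ^ n * M := (Dvd.intro_left _ hq'.symm).trans hqN
      have hcop : Nat.Coprime 8 q' := by
        rw [show (8 : ℕ) = 2 ^ 3 by norm_num]
        exact (Nat.coprime_two_left.mpr (Nat.odd_iff.mpr (Nat.two_dvd_ne_zero.mp hq'odd))).pow_left 3
      rw [hq', show 4 * (2 * q') = 8 * q' by ring]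
      exact hcop.mul_dvd_of_dvd_of_dvd h8 hq'N
    · have hcop : Nat.Coprime 4 q := by
        rw [show (4 : ℕ) = 2 ^ 2 by norm_num]
        exact (Nat.coprime_two_left.mpr (Nat.odd_iff.mpr (Nat.two_dvd_ne_zero.mp h2))).pow_left 2
      exact hcop.mul_dvd_of_dvd_of_dvd h4N hqN
  -- the character
  refine ⟨kroneckerChar (2 ^ n * M) q h4qN hN0, ⟨kroneckerChar_neg_one h4qN hN0, ?_⟩, ?_⟩
  · -- it kills the cusp stabilisers `1 + k·c·w_c`
    intro k c _ _
    set w := 2 ^ n * M / Nat.gcd (2 ^ n * M) (c * c) with hw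
    have hNsq : 2 ^ n * M ∣ (c * w) ^ 2 := by
      obtain ⟨c', hc'⟩ := Nat.gcd_dvd_right (2 ^ n * M) (c * c)
      have hgw : Nat.gcd (2 ^ n * M) (c * c) * w = 2 ^ n * M := Nat.mul_div_cancel' (Nat.gcd_dvd_left _ _)
      refine ⟨c' * w, ?_⟩
      calc (c * w) ^ 2 = (c * c) * (w * w) := by ring
        _ = (Nat.gcd (2 ^ n * M) (c * c) * c') * (w * w) := by rw [← hc']
        _ = (Nat.gcd (2 ^ n * M) (c * c) * w) * (c' * w) := by ring
        _ = 2 ^ n * M * (c' * w) := by rw [hgw]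
    have hy : 1 + k * c * w = 1 + k * (c * w) := by ring
    have hcw2 : 2 ∣ c * w :=
      Nat.prime_two.dvd_of_dvd_pow (((dvd_pow_self 2 (by omega : n ≠ 0)).mul_right M).trans hNsq)
    have hqcw : q ∣ c * w := (hsq.dvd_pow_iff_dvd two_ne_zero).mp (hqN.trans hNsq)
    have hv2 : ∀ a e : ℕ, 2 ^ a ∣ 2 ^ n * M → 2 * e ≤ a + 1 → 2 ^ e ∣ c * w := by
      intro a e ha hea
      have h := ha.trans hNsq
      rcases Nat.eq_zero_or_pos (c * w) with h0 | hpos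
      · rw [h0]; exact dvd_zero _
      haveI := Fact.mk Nat.prime_two
      have h1 : a ≤ padicValNat 2 ((c * w) ^ 2) := (padicValNat_dvd_iff_le (by positivity)).mp h
      rw [padicValNat.pow (c * w) 2] at h1
      exact (padicValNat_dvd_iff_le hpos.ne').mpr (by omega)
    have hcop : Nat.Coprime (1 + k * c * w) (2 ^ n * M) := by
      have h1 : Nat.Coprime (1 + k * (c * w)) (c * w) := by
        rw [show 1 + k * (c * w) = 1 + (c * w) * k by ring]
        exact (Nat.coprime_add_mul_left_left 1 (c * w) k).mpr (Nat.coprime_one_left _)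
      rw [hy]
      exact Nat.Coprime.coprime_dvd_right hNsq (h1.pow_right 2)
    rw [kroneckerChar_apply_natCast h4qN hN0 hcop, hy]
    apply jacobiSym_one_add_eq_one hq0.ne'
    · exact hcw2.trans (Dvd.intro_left _ rfl)
    · exact hqcw.trans (Dvd.intro_left _ rfl)
    · by_cases h8 : 8 ∣ 2 ^ n * M
      · left
        have h4 : 2 ^ 2 ∣ c * w := hv2 3 2 (by rw [show (2 : ℕ) ^ 3 = 8 by norm_num]; exact h8) (by norm_num)
        rw [show (2 : ℕ) ^ 2 = 4 by norm_num] at h4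
        exact h4.trans (Dvd.intro_left _ rfl)
      · right
        apply hQ3
        by_contra hn
        apply h8
        rw [show (8 : ℕ) = 2 ^ 3 by norm_num]
        exact (pow_dvd_pow 2 (by omega)).trans (Dvd.intro _ rfl)
    · intro h2
      have h8 : 2 ^ 3 ∣ c * w := hv2 5 3 ((pow_dvd_pow 2 (hQ2 h2)).trans (Dvd.intro _ rfl)) (by norm_num)
      rw [show (2 : ℕ) ^ 3 = 8 by norm_num] at h8
      exact h8.trans (Dvd.intro_left _ rfl)
  · -- its values on odd `d` coprime to `N` are `(s' | |d|)`
    intro d _ hcopd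
    rw [kroneckerChar_apply_int h4qN hN0 hcopd]
    have hm : Nat.Coprime d.natAbs (2 ^ n * M) := by
      have := Int.isCoprime_iff_gcd_eq_one.mp hcopd
      rw [Int.gcd_eq_natAbs, Int.natAbs_natCast] at this
      exact this
    have hbm : (b : ℤ).gcd d.natAbs = 1 := by
      rw [Int.gcd_natCast_natCast]
      have hbs : b ∣ 2 ^ V * S := by rw [← hbq]; exact Dvd.intro (b * q) (by ring)
      have hsm : Nat.Coprime (2 ^ V * S) d.natAbs := by
        rw [← hsVS]; exact Nat.Coprime.coprime_dvd_left hsN (hm.symm.pow_left _)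
      exact Nat.Coprime.coprime_dvd_left hbs hsm
    rw [hsVS, ← hbq]
    push_cast
    rw [jacobiSym.mul_left, jacobiSym.sq_one' hbm, one_mul]

end Summit.BirchSwinnertonDyer.Rank1Residual.ManinAdditive.SigmaEta
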